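import Literature.AlgebraicGeometry.ComplexMultiplication.CyclotomicCMTypeIsogenyClasses
import Literature.AlgebraicGeometry.ComplexMultiplication.CyclotomicFermatCMTypesOddTwoPrimeLevelExceptional
import Literature.AlgebraicGeometry.ComplexMultiplication.CyclotomicFermatCMTypesTheoremTwoFamilies
import HarnessLib

/-!
# Koblitz–Rohrlich, §2 Remark 2: THE ISOGENIES `J_{1,4,16} ∼ E⁶` (`N = 21`) and `J_{1,16,22} ∼ E¹²` (`N = 39`) — every abelian variety of
# the two exceptional Fermat types is isogenous to a power of a CM ELLIPTIC CURVE, whose CM field is located inside `ℚ(ζ_N)`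

Layer `Literature/AlgebraicGeometry/ComplexMultiplication`; §1 in namespace `…ComplexMultiplication` (any CM type of `ℚ(ζ_N)`), §§2–3 in
`…ComplexMultiplication.CyclotomicFermatCMType`.  Sequel of `CyclotomicCMTypeIsogenyClasses` (gen 14: the Shimura–Taniyama factor count
`A ∼ B^{|W|}` for every CM type of `ℚ(ζ_N)`, `exists_isIsogeny_power_simple_cyclotomic`; `[L : K₁] = |W|`, `K₁ = L^{H'}`) and of
`CyclotomicFermatCMTypesOddTwoPrimeLevelExceptional` (gen 35: `H_{1,4,16}` mod `21` and `H_{1,16,22}` mod `39` are their own stabilisers,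
`|W| = 6, 12 = φ(N)/2`), whose honest column reads: "`J_{1,4,16}` is isogenous to the product of `6` copies of [an] elliptic curve" and the
`12` copies at `39` are NOT typed as isogenies … Likewise "the same elliptic curve" / "does not occur for prime `N`" (the CM fields `ℚ(√−7)`,
`ℚ(√−39)`) are not typed."  THIS FILE types them.  THEOREMS ONLY (no definition, no named fact, no `sorry`); kernel `decide` for the four
residue tables, everything else from the tree (Shimura §6.2 Thm. 3 / §8.2 Prop. 26 road of gen 14) and Mathlib's Galois correspondence.

THE SOURCE.  N. Koblitz, D. Rohrlich, *Simple factors in the Jacobian of a Fermat curve*, Canad. J. Math. **30** (1978) 1183–1205, §2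
Remark 2 (p. 1193): "When `N = 21, 39`, the non-obvious isogenies in the relatively prime case all turn out to occur when `J_{r,s,t}` is
isogenous to a product of elliptic curves.  In each case we can take `(r, s, t)` to be `(1, ρ, ρ²)` where `ρ` is a cube root of `1 mod N`.
For `N = 21`, `J_{1,4,16}` is isogenous to the product of `6` copies of the same elliptic curve that occurs for `N = 7` and the triple
`(1, 2, 4)`.  (Recall that if `N` is a prime `≡ 1 mod 3`, then `J_{1,ρ,ρ²}` splits up into `3` curves of genus `(N − 1)/6`.)  For `N = 39`,
`J_{1,16,22}` is isogenous to a product of `12` copies of an elliptic curve that does not occur as a simple factor for prime `N`."; §1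
(p. 1184): "`L_{r,s}` is isogenous to a product of `|W_{r,s}|` isomorphic simple factors … These factors have complex multiplication by an
order of the fixed field of `W_{r,s}` and CM-type equal to `H_{r,s}/W_{r,s}`."

## What is proved

* §1 (ANY level `N`, any CM type `Φ` of `L = ℚ(ζ_N)`, `W = {t ∈ (ℤ/N)ˣ | S_Φ·t = S_Φ}` its residue stabiliser, `(K₁; Φ₁)` a primitive
  sub-pair inducing `Φ`):
  `forall_apply_eq_iff_autResidue_mem_filter` — **`Gal(L/K₁) = {u | a(u) ∈ W}`** (`u` fixes `K₁` pointwise iff its exponent stabilises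
  `S_Φ`: "the fixed field of `W`", Galois correspondence `Gal(L/L^{H'}) = H'` at gen 14's `K₁ = L^{H'}`, `H' ≅ W`);
  `apply_zetaOf_pow_eq_iff` (`u(ζ^k) = ζ^k ⟺ k·a(u) = k`); `isCyclotomicExtension_adjoin_zetaOf_pow` (`ℚ(ζ_N^a) ⊂ ℚ(ζ_N)` is the `b`-th
  cyclotomic field, `N = ab`); **`le_adjoin_zetaOf_pow_of_forall_mem_filter`** (`{t unit | kt = k} ⊆ W ⟹ K₁ ⊆ ℚ(ζ_N^k)`) and
  **`not_le_adjoin_zetaOf_pow_of_exists_not_mem_filter`** (a unit `t ∉ W` with `kt = k` ⟹ `K₁ ⊄ ℚ(ζ_N^k)`);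
  **`exists_isIsogeny_power_elliptic_of_two_mul_card_filter`** — if `2·|W| = φ(N)` then `K₁` is IMAGINARY QUADRATIC (`[K₁ : ℚ] = 2`, a CM
  field, `[L : K₁] = |W|`), the simple factor `E` of type `(K₁; Φ₁)` has `dim E = 1`, and `A → E^{|W|}` is an `𝓞_{K₁}`-equivariant isogeny
  onto a categorical power, for EVERY realisation `A` of `Φ`.
* §2 (`N = 21`, `ρ = 4`): `filter_stabilizer_eq_fermatCMType_twentyOne` (`W_{1,4,16} = H_{1,4,16}` as finite sets),
  `card_filter_stabilizer_twentyOne` (`|W| = 6`), `mem_fermatCMType_twentyOne_of_three_mul_eq` (the exponents of `Gal(ℚ(ζ₂₁)/ℚ(ζ₇))`, `t ∈ {1, 8}`, lie in `H`);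
  **`exists_isIsogeny_pow_six_elliptic_twentyOne`** — for EVERY abelian variety `A` of type `(ℚ(ζ₂₁); Φ_{(1,4,16)})`: `K₁` imaginary quadratic
  with `[ℚ(ζ₂₁) : K₁] = 6`, `Gal(ℚ(ζ₂₁)/K₁) = {u | a(u) ∈ H_{1,4,16}}`, **`K₁ ⊆ ℚ(ζ₂₁³)` and `ℚ(ζ₂₁³)` is the `7`-th cyclotomic field** (so `K₁`
  is the imaginary quadratic subfield of `ℚ(ζ₇)`: "the same elliptic curve that occurs for `N = 7` and the triple `(1, 2, 4)`", cf. gen 14's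
  `exists_isIsogeny_cube_elliptic_seven`), `E` a SIMPLE ELLIPTIC CURVE of the primitive type `(K₁; Φ₁)`, and an equivariant ISOGENY
  `A → E⁶`; short form `…'` (`∃ E` simple, CM, `dim E = 1`, `A ∼ E⁶`) and the non-vacuous
  `exists_realisation_isIsogeny_pow_six_elliptic_twentyOne` (such an `A`, of dimension `6`, exists — Shimura §6.2 Thm. 3).
* §3 (`N = 39`, `ρ = 16`): the same with `|W| = 12`, **`exists_isIsogeny_pow_twelve_elliptic_thirtyNine`**: `A → E¹²`, `E` a simple CM elliptic
  curve, `K₁` imaginary quadratic with `[ℚ(ζ₃₉) : K₁] = 12`, and **`K₁ ⊄ ℚ(ζ₃₉³)` (the `13`-th cyclotomic field) and `K₁ ⊄ ℚ(ζ₃₉¹³)` (the `3`-rd)**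
  — witnesses: `a(u) = 14` fixes `ζ¹³…` resp. `a(u) = 7`, both outside `H_{1,16,22}` (`witnesses_thirtyNine`); short form and non-vacuity.

## Honest column / NOT here

* K–R speak of the Jacobian factors `J_{r,s,t}`; as in all siblings the statements are about EVERY abelian variety realising the CM type
  `Φ_{H_{r,s,t}}` of `ℚ(ζ_N)` on `H¹` (`IsCMTypeRealisation`; any two are isogenous, Shimura §6.1 Cor.), and "isogenous to `E⁶`" is an
  isogeny `A → P` onto a categorical product `P = ∏_{Fin 6} E` (`Fan.mk P π` a limit), as in gen 14's `exists_isIsogeny_cube_elliptic_seven`.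
* "the same elliptic curve that occurs for `N = 7`": typed as `K₁ ⊆ ℚ(ζ₂₁³) = ℚ(ζ₇)` with `[K₁ : ℚ] = 2` (the CM field of `E` is the
  imaginary quadratic subfield of `ℚ(ζ₇)`); the identification `K₁ = ℚ(√−7)` (Gauss sum) and an explicit isogeny between `E` and the level-`7`
  curve of `exists_isIsogeny_cube_elliptic_seven` (elliptic curves with CM by the same imaginary quadratic field are isogenous over `ℂ`) are NOT
  typed.  "does not occur as a simple factor for prime `N`": typed as `K₁ ⊄ ℚ(ζ₃)`, `K₁ ⊄ ℚ(ζ₁₃)` inside `ℚ(ζ₃₉)` (so `K₁` is the third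
  quadratic subfield, `ℚ(√−39)`); the comparison with the simple factors at prime levels (CM fields inside `ℚ(ζ_p)`) is NOT typed.
* `W` is written out as gen 14's `Finset.filter` over `unitResidues N` (no new definition); the four residue facts are kernel `decide`s at
  `21`, `39`.  Private: `zpow_apply_eq_of_apply_eq`.

## References

* [KoblitzRohrlich1978] N. Koblitz, D. Rohrlich, Canad. J. Math. 30 (1978) 1183–1205: §1 (p. 1184), §2 Remark 2 (p. 1193).
* [Shimura1998] G. Shimura, *Abelian Varieties with Complex Multiplication and Modular Functions* (1998), §6.2 Theorem 3, §8.2 Prop. 26,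
  §8.4 Example (1) (through `CyclotomicCMTypeIsogenyClasses`, `ShimuraIsogenousPowerHolds`, `CyclotomicCMTypeResidueSets`).
* [MilneCM2006] J. S. Milne, *Complex Multiplication* (course notes), Ch. I §3, proof of Prop. 3.13 (through `SimpleCMAbelianVarietyIsogenyClasses`).
* [Washington1997] L. C. Washington, *Introduction to Cyclotomic Fields*, Thm. 2.5 (`Gal(ℚ(ζ_N)/ℚ) ≅ (ℤ/N)ˣ`).

## Provenance

Cell `pub-hodgecm2` (COR-CM), literature seat `lit-deligne-3` gen 36 (claim KR78-REMARK2-ISOGENIES; count-neutral, own lane).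
-/

noncomputable section

open NumberField

namespace Literature.AlgebraicGeometry.ComplexMultiplication

open CategoryTheory CategoryTheory.Limits
open Literature.AlgebraicGeometry.Motives (CMType AbelianVariety)
open Literature.AlgebraicGeometry.Motives.AbelianVariety
open Literature.AlgebraicGeometry.HodgeTheory (complexBetti fermatCMType)
open Literature.NumberTheory.ComplexMultiplication
open Literature.AlgebraicGeometry.Pohlmann1968 Literature.AlgebraicGeometry.Pohlmann1968.Cyclotomic
open CyclotomicCMTypeResidueSets (unitResidues residueSet autResidue IsCMResidueSet residueSet_cmTypeOfResidues
  autResidue_mem_unitResidues exists_autResidue_eq autResidue_spec coprime_iff_mem_unitResidues)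
open scoped Pointwise

/-! ## §1 Any level `N`: the field of the simple factor is cut out by the residue stabiliser; `2·|W| = φ(N)` forces elliptic factors -/

section General

variable {N : ℕ} [NeZero N] {L : Type} [Field L] [NumberField L] [IsCyclotomicExtension {N} ℚ L]
  {Φ : CMType L} {A : AbelianVariety ℂ} {ι : 𝓞 L →+* End A} {θ : L →+* Module.End ℂ (complexBetti A.X 1)}

/-- **The field of the primitive sub-pair read on residues.**  If `(K₁; Φ₁)` is a primitive sub-pair inducing the CM type `Φ` of
`L = ℚ(ζ_N)` (`Φ = Φ₁^L`), then an automorphism `u` of `L` fixes `K₁` pointwise iff its exponent `a(u)` (`ζ^u = ζ^{a(u)}`) lies in the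
residue stabiliser `W = {t ∈ (ℤ/N)ˣ | S_Φ·t = S_Φ}`: `Gal(L/K₁) = H' ≅ W` («complex multiplication by an order of the fixed field of
`W_{r,s}`»; Galois correspondence `Gal(L/L^{H'}) = H'`). [cite: KoblitzRohrlich1978, §1 p. 1184] [cite: Shimura1998, §8.2 Prop. 26 and its proof] -/
theorem forall_apply_eq_iff_autResidue_mem_filter {K₁ : IntermediateField ℚ L} (Φ₁ : CMType K₁)
    (h₁ : inducedCMType (algebraMap K₁ L) Φ₁ = Φ)
    (hp₁ : ∀ s t : K₁ →+* ℂ,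
      (∀ τ : ℂ ≃+* ℂ, (τ : ℂ →+* ℂ).comp s ∈ Φ₁.1 ↔ (τ : ℂ →+* ℂ).comp t ∈ Φ₁.1) → s = t)
    (u : L ≃ₐ[ℚ] L) :
    (∀ x : L, x ∈ K₁ → u x = x) ↔
      autResidue N L u ∈ (unitResidues N).filter fun t =>
        ∀ c ∈ unitResidues N, (c * t ∈ residueSet N Φ ↔ c ∈ residueSet N Φ) := by
  haveI : IsGalois ℚ L := IsCyclotomicExtension.isGalois {N} ℚ L
  obtain ⟨ι₀⟩ : Nonempty (L →+* ℂ) := inferInstance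
  have h36 := eq_fixedField_stabilizer_of_primitive Φ ι₀ Φ₁ h₁ hp₁
  have hfix : K₁.fixingSubgroup =
      MulAction.stabilizer (L ≃ₐ[ℚ] L) (reflexLift (algValuedIn ι₀ Φ.1) (AlgHom.id ℚ L) : Set (L ≃ₐ[ℚ] L)) := by
    rw [h36, IntermediateField.fixingSubgroup_fixedField]
  rw [Finset.mem_filter, ← mem_stabilizer_iff_forall_unitResidues (N := N) Φ ι₀ u, ← hfix,
    IntermediateField.mem_fixingSubgroup_iff]
  exact ⟨fun h => ⟨autResidue_mem_unitResidues N u, h⟩, fun h => h.2⟩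

/-- **`u(ζ^k) = ζ^k ⟺ k·a(u) = k` in `ℤ/N`**: which automorphisms of `ℚ(ζ_N)` fix the sub-cyclotomic generator `ζ_N^k` (so that
`Gal(ℚ(ζ_N)/ℚ(ζ_N^k)) = {u | k·a(u) ≡ k}`). [cite: Washington1997, Thm. 2.5] -/
theorem apply_zetaOf_pow_eq_iff (u : L ≃ₐ[ℚ] L) (k : ℕ) :
    u (zetaOf N L ^ k) = zetaOf N L ^ k ↔ (k : ZMod N) * autResidue N L u = k := by
  have hζ : IsPrimitiveRoot (zetaOf N L) N := IsCyclotomicExtension.zeta_spec N ℚ L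
  have hfin : IsOfFinOrder (zetaOf N L) := hζ.isOfFinOrder (NeZero.ne N)
  rw [map_pow, autResidue_spec, ← pow_mul, hfin.pow_eq_pow_iff_modEq, ← hζ.eq_orderOf, ← ZMod.natCast_eq_natCast_iff,
    Nat.cast_mul, ZMod.natCast_zmod_val, mul_comm]

/-- **`ℚ(ζ_N^a) ⊂ ℚ(ζ_N)` is the `b`-th cyclotomic field for `N = a·b`** (`ζ_N^a` is a primitive `b`-th root of unity; Mathlib).
[cite: Washington1997, Thm. 2.5] -/
theorem isCyclotomicExtension_adjoin_zetaOf_pow {a b : ℕ} [NeZero b] (hN : N = a * b) :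
    IsCyclotomicExtension {b} ℚ (IntermediateField.adjoin ℚ {zetaOf N L ^ a}) :=
  IsPrimitiveRoot.intermediateField_adjoin_isCyclotomicExtension (K := ℚ)
    ((IsCyclotomicExtension.zeta_spec N ℚ L).pow (Nat.pos_of_ne_zero (NeZero.ne N)) hN)

/-- **`K₁ ⊆ ℚ(ζ_N^k)` read on residues**: if every unit residue `t` with `k·t = k` lies in the residue stabiliser `W` of `Φ`, then the field
`K₁` of the primitive sub-pair lies in the sub-cyclotomic field `ℚ(ζ_N^k) ⊂ ℚ(ζ_N)` (Galois correspondence: `Gal(L/ℚ(ζ^k)) ⊆ Gal(L/K₁)`).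
[cite: KoblitzRohrlich1978, §1 p. 1184 and §2 Remark 2 (p. 1193)] [cite: Shimura1998, §8.2 Prop. 26] -/
theorem le_adjoin_zetaOf_pow_of_forall_mem_filter {K₁ : IntermediateField ℚ L} (Φ₁ : CMType K₁)
    (h₁ : inducedCMType (algebraMap K₁ L) Φ₁ = Φ)
    (hp₁ : ∀ s t : K₁ →+* ℂ,
      (∀ τ : ℂ ≃+* ℂ, (τ : ℂ →+* ℂ).comp s ∈ Φ₁.1 ↔ (τ : ℂ →+* ℂ).comp t ∈ Φ₁.1) → s = t)
    (k : ℕ)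
    (hk : ∀ t ∈ unitResidues N, (k : ZMod N) * t = k →
      t ∈ (unitResidues N).filter fun t => ∀ c ∈ unitResidues N, (c * t ∈ residueSet N Φ ↔ c ∈ residueSet N Φ)) :
    K₁ ≤ IntermediateField.adjoin ℚ {zetaOf N L ^ k} := by
  haveI : IsGalois ℚ L := IsCyclotomicExtension.isGalois {N} ℚ L
  rw [← IsGalois.fixedField_fixingSubgroup (IntermediateField.adjoin ℚ {zetaOf N L ^ k}),
    IntermediateField.le_iff_le]
  intro u hu
  rw [IntermediateField.mem_fixingSubgroup_iff] at hu ⊢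
  have hζ : u (zetaOf N L ^ k) = zetaOf N L ^ k := hu _ (IntermediateField.mem_adjoin_simple_self ℚ _)
  exact (forall_apply_eq_iff_autResidue_mem_filter (N := N) Φ₁ h₁ hp₁ u).2
    (hk _ (autResidue_mem_unitResidues N u) ((apply_zetaOf_pow_eq_iff u k).1 hζ))

/-- Powers of an automorphism fixing `y` fix `y`. [folklore] -/
private theorem zpow_apply_eq_of_apply_eq (u : L ≃ₐ[ℚ] L) (n : ℤ) {y : L} (hy : u y = y) : (u ^ n) y = y := by
  have hnat : ∀ m : ℕ, (u ^ m) y = y := fun m => by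
    induction m with
    | zero => rfl
    | succ m ih => rw [pow_succ, AlgEquiv.mul_apply, hy, ih]
  cases n with
  | ofNat m => simpa using hnat m
  | negSucc m =>
    have h := hnat (m + 1)
    rw [zpow_negSucc]
    conv_lhs => rw [← h]
    rw [← AlgEquiv.mul_apply, inv_mul_cancel, AlgEquiv.one_apply]

/-- **`K₁ ⊄ ℚ(ζ_N^k)` read on residues**: if some unit residue `t` with `k·t = k` is NOT in the residue stabiliser `W` of `Φ`, then `K₁`
is not contained in `ℚ(ζ_N^k)` (the automorphism `u` with `a(u) = t` fixes `ζ^k` but moves `K₁`).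
[cite: KoblitzRohrlich1978, §1 p. 1184 and §2 Remark 2 (p. 1193)] [cite: Shimura1998, §8.2 Prop. 26] -/
theorem not_le_adjoin_zetaOf_pow_of_exists_not_mem_filter {K₁ : IntermediateField ℚ L} (Φ₁ : CMType K₁)
    (h₁ : inducedCMType (algebraMap K₁ L) Φ₁ = Φ)
    (hp₁ : ∀ s t : K₁ →+* ℂ,
      (∀ τ : ℂ ≃+* ℂ, (τ : ℂ →+* ℂ).comp s ∈ Φ₁.1 ↔ (τ : ℂ →+* ℂ).comp t ∈ Φ₁.1) → s = t)
    (k : ℕ)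
    (hk : ∃ t ∈ unitResidues N, (k : ZMod N) * t = k ∧
      t ∉ (unitResidues N).filter fun t => ∀ c ∈ unitResidues N, (c * t ∈ residueSet N Φ ↔ c ∈ residueSet N Φ)) :
    ¬K₁ ≤ IntermediateField.adjoin ℚ {zetaOf N L ^ k} := by
  haveI : IsGalois ℚ L := IsCyclotomicExtension.isGalois {N} ℚ L
  obtain ⟨t, htU, hkt, ht⟩ := hk
  obtain ⟨u, hu⟩ := exists_autResidue_eq N (L := L) t htU
  intro hle
  -- `u` fixes `ζ^k`, hence `ℚ(ζ^k)`, hence `K₁`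
  have hfixζ : u (zetaOf N L ^ k) = zetaOf N L ^ k := (apply_zetaOf_pow_eq_iff u k).2 (by rw [hu, hkt])
  have hadj : IntermediateField.adjoin ℚ {zetaOf N L ^ k} ≤ IntermediateField.fixedField (Subgroup.zpowers u) := by
    rw [IntermediateField.adjoin_le_iff]
    rintro x hx
    rw [Set.mem_singleton_iff] at hx
    subst hx
    rw [SetLike.mem_coe, IntermediateField.mem_fixedField_iff]
    rintro f ⟨n, rfl⟩
    exact zpow_apply_eq_of_apply_eq u n hfixζ
  have hK : ∀ x : L, x ∈ K₁ → u x = x := fun x hx =>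
    (IntermediateField.mem_fixedField_iff (Subgroup.zpowers u) x).1 (hadj (hle hx)) u (Subgroup.mem_zpowers u)
  have := (forall_apply_eq_iff_autResidue_mem_filter (N := N) Φ₁ h₁ hp₁ u).1 hK
  rw [hu] at this
  exact ht this

/-- **Self-dual stabilisers give ELLIPTIC factors** (Koblitz–Rohrlich p. 1184 with `|W| = φ(N)/2`): for a realisation `A` of a CM type `Φ`
of `L = ℚ(ζ_N)` whose residue stabiliser `W` has `2·|W| = φ(N)` (i.e. `W` has index `2` in `(ℤ/N)ˣ`), the simple factor is an
elliptic curve: there are the primitive sub-pair `(K₁; Φ₁)` with `K₁` an IMAGINARY QUADRATIC field (`[K₁ : ℚ] = 2`, a CM field,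
`[L : K₁] = |W|`, `Gal(L/K₁) ≅ W`), a SIMPLE abelian variety `E` of type `(K₁; Φ₁)` of DIMENSION `1`, and an `𝓞_{K₁}`-equivariant
ISOGENY `A → E^{|W|}` onto a categorical power. [cite: KoblitzRohrlich1978, §1 p. 1184 and §2 Remark 2 (p. 1193)]
[cite: Shimura1998, §8.2 Prop. 26 and §6.2 Theorem 3] [cite: MilneCM2006, Ch. I §3, proof of Prop. 3.13] -/
theorem exists_isIsogeny_power_elliptic_of_two_mul_card_filter [IsCMField L] (hA : IsCMTypeRealisation Φ A ι θ)
    (hW : 2 * ((unitResidues N).filter fun t =>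
        ∀ c ∈ unitResidues N, (c * t ∈ residueSet N Φ ↔ c ∈ residueSet N Φ)).card = N.totient) :
    ∃ (K₁ : IntermediateField ℚ L) (Φ₁ : CMType K₁), IsCMField K₁ ∧ Module.finrank ℚ K₁ = 2 ∧
      inducedCMType (algebraMap K₁ L) Φ₁ = Φ ∧
      (∀ s t : K₁ →+* ℂ,
        (∀ τ : ℂ ≃+* ℂ, (τ : ℂ →+* ℂ).comp s ∈ Φ₁.1 ↔ (τ : ℂ →+* ℂ).comp t ∈ Φ₁.1) → s = t) ∧
      (∀ u : L ≃ₐ[ℚ] L, (∀ x : L, x ∈ K₁ → u x = x) ↔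
        autResidue N L u ∈ (unitResidues N).filter fun t =>
          ∀ c ∈ unitResidues N, (c * t ∈ residueSet N Φ ↔ c ∈ residueSet N Φ)) ∧
      ∃ (E : AbelianVariety ℂ) (ιE : 𝓞 K₁ →+* End E) (θE : K₁ →+* Module.End ℂ (complexBetti E.X 1)),
        IsCMTypeRealisation Φ₁ E ιE θE ∧ E.IsSimple ∧ E.dim = 1 ∧
        ∃ (h : ℕ) (P : AbelianVariety ℂ) (π : Fin h → (P ⟶ E)), Nonempty (IsLimit (Fan.mk P π)) ∧
          h = Module.finrank K₁ L ∧
          h = ((unitResidues N).filter fun t =>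
            ∀ c ∈ unitResidues N, (c * t ∈ residueSet N Φ ↔ c ∈ residueSet N Φ)).card ∧
          2 * h = N.totient ∧
          ∃ g : A ⟶ P, IsIsogeny g ∧
            ∀ (j : Fin h) (b : 𝓞 K₁),
              ι (RingOfIntegers.mapRingHom (algebraMap K₁ L : K₁ →+* L) b) ≫ (g ≫ π j) = (g ≫ π j) ≫ ιE b := by
  obtain ⟨K₁, Φ₁, hCM, h₁, hp₁, B, ιB, θB, hB, hs, hdimB, h, P, π, hP, hh, g, hg, hequiv⟩ :=
    exists_isIsogeny_power_simple_of_isCMTypeRealisation hA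
  have hhK : h = Module.finrank K₁ L := eq_finrank_of_mul_finrank_eq K₁ hh
  have hW₁ := finrank_eq_card_filter_of_primitive (N := N) Φ Φ₁ h₁ hp₁
  have hL : Module.finrank ℚ L = N.totient := finrank_eq_totient N L
  have hpos : 0 < Module.finrank K₁ L := Module.finrank_pos
  -- `[K₁ : ℚ] = 2`
  have hK2 : Module.finrank ℚ K₁ = 2 := by
    have e1 : Module.finrank ℚ K₁ * Module.finrank K₁ L = 2 * Module.finrank K₁ L := by
      rw [Module.finrank_mul_finrank ℚ K₁ L, hL, ← hW, ← hW₁]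
    exact Nat.eq_of_mul_eq_mul_right hpos e1
  refine ⟨K₁, Φ₁, hCM, hK2, h₁, hp₁, fun u => forall_apply_eq_iff_autResidue_mem_filter (N := N) Φ₁ h₁ hp₁ u, B, ιB, θB, hB, hs, ?_,
    h, P, π, hP, hhK, hhK.trans hW₁, ?_, g, hg, hequiv⟩
  · -- `2 dim E = [K₁ : ℚ] = 2`
    rw [hK2] at hdimB
    omega
  · rw [hhK, hW₁, hW]

end General

/-! ## §2 `N = 21`: `J_{1,4,16} ∼ E⁶`, `E` the CM elliptic curve of the imaginary quadratic subfield of `ℚ(ζ₇) = ℚ(ζ₂₁³)` -/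

namespace CyclotomicFermatCMType

section TwentyOne

/-- `ρ = 4` is a cube root of unity modulo `21` with `ρ² = 16` ("we can take `(r, s, t)` to be `(1, ρ, ρ²)`"); kernel check.
[cite: KoblitzRohrlich1978, §2 Remark 2 (p. 1193)] -/
theorem cubeRoot_twentyOne : (4 : ZMod 21) ^ 3 = 1 ∧ (4 : ZMod 21) ^ 2 = 16 ∧ (1 : ZMod 21) + 4 + 16 = 0 := by
  decide

/-- **`W_{1,4,16} = H_{1,4,16}` as finite sets**: the residue stabiliser `{t ∈ (ℤ/21)ˣ | H·t = H}` of `H_{1,4,16}` IS `H_{1,4,16} =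
{1, 2, 4, 8, 11, 16}` (kernel computation; cf. `forall_mem_iff_mul_mem_iff_mem_twentyOne`). [cite: KoblitzRohrlich1978, §2 Remark 2 (p. 1193)] -/
theorem filter_stabilizer_eq_fermatCMType_twentyOne :
    ((unitResidues 21).filter fun t => ∀ c ∈ unitResidues 21,
        (c * t ∈ fermatCMType 21 1 4 16 ↔ c ∈ fermatCMType 21 1 4 16)) = fermatCMType 21 1 4 16 := by
  rw [fermatCMType_twentyOne_one_four_sixteen]
  decide

/-- The unit residues `t` modulo `21` with `3t = 3` (the exponents of `Gal(ℚ(ζ₂₁)/ℚ(ζ₇))`, `ζ₇ = ζ₂₁³`) are `1` and `8`, both in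
`H_{1,4,16}` (kernel computation: `H_{1,4,16}` is pulled back from level `7`). [cite: KoblitzRohrlich1978, §2 Remark 2 (p. 1193)] -/
theorem mem_fermatCMType_twentyOne_of_three_mul_eq :
    ∀ t ∈ unitResidues 21, (3 : ZMod 21) * t = 3 → t ∈ fermatCMType 21 1 4 16 := by
  rw [fermatCMType_twentyOne_one_four_sixteen]
  decide

variable {L : Type} [Field L] [NumberField L] [IsCyclotomicExtension {21} ℚ L]
  {hS : ∀ c : ZMod 21, c.val.Coprime 21 → (c ∈ fermatCMType 21 1 4 16 ↔ -c ∉ fermatCMType 21 1 4 16)}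
  {A : AbelianVariety ℂ} {ι : 𝓞 L →+* End A} {θ : L →+* Module.End ℂ (complexBetti A.X 1)}

/-- The residue set of `Φ_{(1,4,16)}` is `H_{1,4,16}`. [cite: Shimura1998, §8.4 Example (1)] -/
theorem residueSet_fermat_twentyOne :
    residueSet 21 (cmTypeOfResidues (L := L) (fermatCMType 21 1 4 16) hS) = fermatCMType 21 1 4 16 :=
  residueSet_cmTypeOfResidues 21 (isCMResidueSet_fermatCMType hS) _

/-- **`|W_{1,4,16}| = 6 = φ(21)/2`** for the residue stabiliser of `Φ_{(1,4,16)}`. [cite: KoblitzRohrlich1978, §2 Remark 2 (p. 1193)] -/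
theorem card_filter_stabilizer_twentyOne :
    ((unitResidues 21).filter fun t => ∀ c ∈ unitResidues 21,
        (c * t ∈ residueSet 21 (cmTypeOfResidues (L := L) (fermatCMType 21 1 4 16) hS) ↔
          c ∈ residueSet 21 (cmTypeOfResidues (L := L) (fermatCMType 21 1 4 16) hS))).card = 6 := by
  rw [residueSet_fermat_twentyOne, filter_stabilizer_eq_fermatCMType_twentyOne, card_fermatCMType_twentyOne_one_four_sixteen.1]

/-- **KOBLITZ–ROHRLICH §2 REMARK 2 AT `N = 21`, THE ISOGENY**: "For `N = 21`, `J_{1,4,16}` is isogenous to the product of `6` copies of the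
same elliptic curve that occurs for `N = 7` and the triple `(1, 2, 4)`."  For EVERY abelian variety `A` of type `(ℚ(ζ₂₁); Φ_{(1,4,16)})`
(dimension `6`): there are an IMAGINARY QUADRATIC subfield `K₁ ⊂ ℚ(ζ₂₁)` (`[K₁ : ℚ] = 2`, `[ℚ(ζ₂₁) : K₁] = 6 = |W_{1,4,16}|`, `Gal(ℚ(ζ₂₁)/K₁) =
{u | a(u) ∈ H_{1,4,16}}`) CONTAINED IN `ℚ(ζ₂₁³) = ℚ(ζ₇)` — so `K₁` is the imaginary quadratic subfield `ℚ(√−7)` of `ℚ(ζ₇)`, the CM field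
of the level-`7` curve of `exists_isIsogeny_cube_elliptic_seven` — a primitive CM type `Φ₁` of `K₁` inducing `Φ_{(1,4,16)}`, a SIMPLE
ELLIPTIC CURVE `E` (`dim E = 1`) of type `(K₁; Φ₁)`, and an `𝓞_{K₁}`-equivariant ISOGENY `A → E⁶` onto a categorical sixth power.
[cite: KoblitzRohrlich1978, §2 Remark 2 (p. 1193) and §1 p. 1184] [cite: Shimura1998, §8.2 Prop. 26 and §6.2 Theorem 3]
[cite: MilneCM2006, Ch. I §3, proof of Prop. 3.13] -/
theorem exists_isIsogeny_pow_six_elliptic_twentyOne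
    (hA : IsCMTypeRealisation (cmTypeOfResidues (L := L) (fermatCMType 21 1 4 16) hS) A ι θ) :
    ∃ (K₁ : IntermediateField ℚ L) (Φ₁ : CMType K₁), IsCMField K₁ ∧ Module.finrank ℚ K₁ = 2 ∧
      Module.finrank K₁ L = 6 ∧
      inducedCMType (algebraMap K₁ L) Φ₁ = cmTypeOfResidues (L := L) (fermatCMType 21 1 4 16) hS ∧
      (∀ s t : K₁ →+* ℂ,
        (∀ τ : ℂ ≃+* ℂ, (τ : ℂ →+* ℂ).comp s ∈ Φ₁.1 ↔ (τ : ℂ →+* ℂ).comp t ∈ Φ₁.1) → s = t) ∧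
      (∀ u : L ≃ₐ[ℚ] L, (∀ x : L, x ∈ K₁ → u x = x) ↔ autResidue 21 L u ∈ fermatCMType 21 1 4 16) ∧
      (K₁ ≤ IntermediateField.adjoin ℚ {zetaOf 21 L ^ 3} ∧
        IsCyclotomicExtension {7} ℚ (IntermediateField.adjoin ℚ {zetaOf 21 L ^ 3})) ∧
      ∃ (E : AbelianVariety ℂ) (ιE : 𝓞 K₁ →+* End E) (θE : K₁ →+* Module.End ℂ (complexBetti E.X 1)),
        IsCMTypeRealisation Φ₁ E ιE θE ∧ E.IsSimple ∧ E.dim = 1 ∧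
        ∃ (P : AbelianVariety ℂ) (π : Fin 6 → (P ⟶ E)), Nonempty (IsLimit (Fan.mk P π)) ∧
          ∃ g : A ⟶ P, IsIsogeny g ∧
            ∀ (j : Fin 6) (b : 𝓞 K₁),
              ι (RingOfIntegers.mapRingHom (algebraMap K₁ L : K₁ →+* L) b) ≫ (g ≫ π j) = (g ≫ π j) ≫ ιE b := by
  haveI : IsCMField L := IsCyclotomicExtension.Rat.isCMField L (S := {21}) ⟨21, rfl, by norm_num⟩
  have hcard := card_filter_stabilizer_twentyOne (L := L) (hS := hS)
  have htot : Nat.totient 21 = 12 := card_fermatCMType_twentyOne_one_four_sixteen.2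
  obtain ⟨K₁, Φ₁, hCM, hK2, h₁, hp₁, hfix, E, ιE, θE, hE, hs, hdim, h, P, π, hP, hhK, hhW, -, g, hg, hequiv⟩ :=
    exists_isIsogeny_power_elliptic_of_two_mul_card_filter (N := 21) hA (by rw [hcard, htot])
  rw [hcard] at hhW
  subst hhW
  refine ⟨K₁, Φ₁, hCM, hK2, hhK.symm, h₁, hp₁, fun u => ?_, ?_, E, ιE, θE, hE, hs, hdim, P, π, hP, g, hg, hequiv⟩
  · rw [hfix u, residueSet_fermat_twentyOne, filter_stabilizer_eq_fermatCMType_twentyOne]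
  · refine ⟨le_adjoin_zetaOf_pow_of_forall_mem_filter Φ₁ h₁ hp₁ 3 fun t ht h3 => ?_,
      isCyclotomicExtension_adjoin_zetaOf_pow (N := 21) (a := 3) (b := 7) rfl⟩
    rw [residueSet_fermat_twentyOne, filter_stabilizer_eq_fermatCMType_twentyOne]
    exact mem_fermatCMType_twentyOne_of_three_mul_eq t ht (by simpa using h3)

/-- **Short form at `21`**: every abelian variety of type `(ℚ(ζ₂₁); Φ_{(1,4,16)})` is isogenous to `E⁶` for a SIMPLE CM ELLIPTIC CURVE `E`.
[cite: KoblitzRohrlich1978, §2 Remark 2 (p. 1193)] -/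
theorem exists_isIsogeny_pow_six_elliptic_twentyOne'
    (hA : IsCMTypeRealisation (cmTypeOfResidues (L := L) (fermatCMType 21 1 4 16) hS) A ι θ) :
    ∃ (E : AbelianVariety ℂ), E.IsSimple ∧ Milne1999.IsOfCMType E ∧ E.dim = 1 ∧
      ∃ (P : AbelianVariety ℂ) (π : Fin 6 → (P ⟶ E)), Nonempty (IsLimit (Fan.mk P π)) ∧ ∃ g : A ⟶ P, IsIsogeny g := by
  obtain ⟨K₁, Φ₁, -, -, -, -, -, -, -, E, ιE, θE, hE, hs, hdim, P, π, hP, g, hg, -⟩ :=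
    exists_isIsogeny_pow_six_elliptic_twentyOne hA
  exact ⟨E, hs, isOfCMType_of_isCMTypeRealisation hE, hdim, P, π, hP, g, hg⟩

/-- **Non-vacuity at `21`**: there IS a `6`-dimensional abelian variety of type `(ℚ(ζ₂₁); Φ_{(1,4,16)})` (Shimura §6.2 Thm. 3), and it is
isogenous to the sixth power of a simple CM elliptic curve. [cite: KoblitzRohrlich1978, §2 Remark 2 (p. 1193)] [cite: Shimura1998, §6.2 Thm. 3] -/
theorem exists_realisation_isIsogeny_pow_six_elliptic_twentyOne :
    ∃ (hS : ∀ c : ZMod 21, c.val.Coprime 21 → (c ∈ fermatCMType 21 1 4 16 ↔ -c ∉ fermatCMType 21 1 4 16))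
      (A : AbelianVariety ℂ) (ι : 𝓞 L →+* End A) (θ : L →+* Module.End ℂ (complexBetti A.X 1)),
      IsCMTypeRealisation (cmTypeOfResidues (L := L) (fermatCMType 21 1 4 16) hS) A ι θ ∧ A.dim = 6 ∧
      ∃ (E : AbelianVariety ℂ), E.IsSimple ∧ E.dim = 1 ∧
        ∃ (P : AbelianVariety ℂ) (π : Fin 6 → (P ⟶ E)), Nonempty (IsLimit (Fan.mk P π)) ∧ ∃ g : A ⟶ P, IsIsogeny g := by
  obtain ⟨hS, A, ι, θ, hA, hd⟩ := exists_isCMTypeRealisation_fermat (L := L) (M := 21) (by norm_num)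
    (r := 1) (s := 4) (t := 16) (by decide) (by decide) (by decide) (by decide)
  obtain ⟨E, hs, -, hdim, P, π, hP, g, hg⟩ := exists_isIsogeny_pow_six_elliptic_twentyOne' hA
  exact ⟨hS, A, ι, θ, hA, by rw [hd, card_fermatCMType_twentyOne_one_four_sixteen.2], E, hs, hdim, P, π, hP, g, hg⟩

end TwentyOne

/-! ## §3 `N = 39`: `J_{1,16,22} ∼ E¹²`, `E` with CM by an imaginary quadratic subfield of `ℚ(ζ₃₉)` inside neither `ℚ(ζ₃)` nor `ℚ(ζ₁₃)` -/

section ThirtyNine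

/-- `ρ = 16` is a cube root of unity modulo `39` with `ρ² = 22`; kernel check. [cite: KoblitzRohrlich1978, §2 Remark 2 (p. 1193)] -/
theorem cubeRoot_thirtyNine : (16 : ZMod 39) ^ 3 = 1 ∧ (16 : ZMod 39) ^ 2 = 22 ∧ (1 : ZMod 39) + 16 + 22 = 0 := by
  decide

/-- **`W_{1,16,22} = H_{1,16,22}` as finite sets** modulo `39` (kernel computation). [cite: KoblitzRohrlich1978, §2 Remark 2 (p. 1193)] -/
theorem filter_stabilizer_eq_fermatCMType_thirtyNine :
    ((unitResidues 39).filter fun t => ∀ c ∈ unitResidues 39,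
        (c * t ∈ fermatCMType 39 1 16 22 ↔ c ∈ fermatCMType 39 1 16 22)) = fermatCMType 39 1 16 22 := by
  rw [fermatCMType_thirtyNine_one_sixteen_twentyTwo]
  decide

/-- `14` is a unit modulo `39` with `3·14 = 3` (it fixes `ζ₃₉³ = ζ₁₃`) but `14 ∉ H_{1,16,22}`; `7` is a unit with `13·7 = 13` (it fixes
`ζ₃₉¹³ = ζ₃`) but `7 ∉ H_{1,16,22}` (kernel computation). [cite: KoblitzRohrlich1978, §2 Remark 2 (p. 1193)] -/
theorem witnesses_thirtyNine :
    ((14 : ZMod 39) ∈ unitResidues 39 ∧ (3 : ZMod 39) * 14 = 3 ∧ (14 : ZMod 39) ∉ fermatCMType 39 1 16 22) ∧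
      ((7 : ZMod 39) ∈ unitResidues 39 ∧ (13 : ZMod 39) * 7 = 13 ∧ (7 : ZMod 39) ∉ fermatCMType 39 1 16 22) := by
  rw [fermatCMType_thirtyNine_one_sixteen_twentyTwo]
  decide

variable {L : Type} [Field L] [NumberField L] [IsCyclotomicExtension {39} ℚ L]
  {hS : ∀ c : ZMod 39, c.val.Coprime 39 → (c ∈ fermatCMType 39 1 16 22 ↔ -c ∉ fermatCMType 39 1 16 22)}
  {A : AbelianVariety ℂ} {ι : 𝓞 L →+* End A} {θ : L →+* Module.End ℂ (complexBetti A.X 1)}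

/-- The residue set of `Φ_{(1,16,22)}` is `H_{1,16,22}`. [cite: Shimura1998, §8.4 Example (1)] -/
theorem residueSet_fermat_thirtyNine :
    residueSet 39 (cmTypeOfResidues (L := L) (fermatCMType 39 1 16 22) hS) = fermatCMType 39 1 16 22 :=
  residueSet_cmTypeOfResidues 39 (isCMResidueSet_fermatCMType hS) _

/-- **`|W_{1,16,22}| = 12 = φ(39)/2`** for the residue stabiliser of `Φ_{(1,16,22)}`. [cite: KoblitzRohrlich1978, §2 Remark 2 (p. 1193)] -/
theorem card_filter_stabilizer_thirtyNine :
    ((unitResidues 39).filter fun t => ∀ c ∈ unitResidues 39,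
        (c * t ∈ residueSet 39 (cmTypeOfResidues (L := L) (fermatCMType 39 1 16 22) hS) ↔
          c ∈ residueSet 39 (cmTypeOfResidues (L := L) (fermatCMType 39 1 16 22) hS))).card = 12 := by
  rw [residueSet_fermat_thirtyNine, filter_stabilizer_eq_fermatCMType_thirtyNine,
    card_fermatCMType_thirtyNine_one_sixteen_twentyTwo.1]

/-- **KOBLITZ–ROHRLICH §2 REMARK 2 AT `N = 39`, THE ISOGENY**: "For `N = 39`, `J_{1,16,22}` is isogenous to a product of `12` copies of an
elliptic curve that does not occur as a simple factor for prime `N`."  For EVERY abelian variety `A` of type `(ℚ(ζ₃₉); Φ_{(1,16,22)})`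
(dimension `12`): there are an IMAGINARY QUADRATIC subfield `K₁ ⊂ ℚ(ζ₃₉)` (`[K₁ : ℚ] = 2`, `[ℚ(ζ₃₉) : K₁] = 12 = |W_{1,16,22}|`,
`Gal(ℚ(ζ₃₉)/K₁) = {u | a(u) ∈ H_{1,16,22}}`) contained in NEITHER `ℚ(ζ₃₉³) = ℚ(ζ₁₃)` NOR `ℚ(ζ₃₉¹³) = ℚ(ζ₃)` (so `K₁` is the third
quadratic subfield `ℚ(√−39)` — not a subfield of any `ℚ(ζ_p)`, `p` prime), a primitive CM type `Φ₁` of `K₁` inducing `Φ_{(1,16,22)}`, a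
SIMPLE ELLIPTIC CURVE `E` of type `(K₁; Φ₁)`, and an `𝓞_{K₁}`-equivariant ISOGENY `A → E¹²`.
[cite: KoblitzRohrlich1978, §2 Remark 2 (p. 1193) and §1 p. 1184] [cite: Shimura1998, §8.2 Prop. 26 and §6.2 Theorem 3]
[cite: MilneCM2006, Ch. I §3, proof of Prop. 3.13] -/
theorem exists_isIsogeny_pow_twelve_elliptic_thirtyNine
    (hA : IsCMTypeRealisation (cmTypeOfResidues (L := L) (fermatCMType 39 1 16 22) hS) A ι θ) :
    ∃ (K₁ : IntermediateField ℚ L) (Φ₁ : CMType K₁), IsCMField K₁ ∧ Module.finrank ℚ K₁ = 2 ∧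
      Module.finrank K₁ L = 12 ∧
      inducedCMType (algebraMap K₁ L) Φ₁ = cmTypeOfResidues (L := L) (fermatCMType 39 1 16 22) hS ∧
      (∀ s t : K₁ →+* ℂ,
        (∀ τ : ℂ ≃+* ℂ, (τ : ℂ →+* ℂ).comp s ∈ Φ₁.1 ↔ (τ : ℂ →+* ℂ).comp t ∈ Φ₁.1) → s = t) ∧
      (∀ u : L ≃ₐ[ℚ] L, (∀ x : L, x ∈ K₁ → u x = x) ↔ autResidue 39 L u ∈ fermatCMType 39 1 16 22) ∧
      (¬K₁ ≤ IntermediateField.adjoin ℚ {zetaOf 39 L ^ 3} ∧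
        IsCyclotomicExtension {13} ℚ (IntermediateField.adjoin ℚ {zetaOf 39 L ^ 3})) ∧
      (¬K₁ ≤ IntermediateField.adjoin ℚ {zetaOf 39 L ^ 13} ∧
        IsCyclotomicExtension {3} ℚ (IntermediateField.adjoin ℚ {zetaOf 39 L ^ 13})) ∧
      ∃ (E : AbelianVariety ℂ) (ιE : 𝓞 K₁ →+* End E) (θE : K₁ →+* Module.End ℂ (complexBetti E.X 1)),
        IsCMTypeRealisation Φ₁ E ιE θE ∧ E.IsSimple ∧ E.dim = 1 ∧
        ∃ (P : AbelianVariety ℂ) (π : Fin 12 → (P ⟶ E)), Nonempty (IsLimit (Fan.mk P π)) ∧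
          ∃ g : A ⟶ P, IsIsogeny g ∧
            ∀ (j : Fin 12) (b : 𝓞 K₁),
              ι (RingOfIntegers.mapRingHom (algebraMap K₁ L : K₁ →+* L) b) ≫ (g ≫ π j) = (g ≫ π j) ≫ ιE b := by
  haveI : IsCMField L := IsCyclotomicExtension.Rat.isCMField L (S := {39}) ⟨39, rfl, by norm_num⟩
  have hcard := card_filter_stabilizer_thirtyNine (L := L) (hS := hS)
  have htot : Nat.totient 39 = 24 := card_fermatCMType_thirtyNine_one_sixteen_twentyTwo.2
  obtain ⟨K₁, Φ₁, hCM, hK2, h₁, hp₁, hfix, E, ιE, θE, hE, hs, hdim, h, P, π, hP, hhK, hhW, -, g, hg, hequiv⟩ :=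
    exists_isIsogeny_power_elliptic_of_two_mul_card_filter (N := 39) hA (by rw [hcard, htot])
  rw [hcard] at hhW
  subst hhW
  refine ⟨K₁, Φ₁, hCM, hK2, hhK.symm, h₁, hp₁, fun u => ?_, ?_, ?_, E, ιE, θE, hE, hs, hdim, P, π, hP, g, hg, hequiv⟩
  · rw [hfix u, residueSet_fermat_thirtyNine, filter_stabilizer_eq_fermatCMType_thirtyNine]
  · refine ⟨not_le_adjoin_zetaOf_pow_of_exists_not_mem_filter Φ₁ h₁ hp₁ 3 ⟨14, witnesses_thirtyNine.1.1,
      by exact_mod_cast witnesses_thirtyNine.1.2.1, ?_⟩, isCyclotomicExtension_adjoin_zetaOf_pow (N := 39) (a := 3) (b := 13) rfl⟩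
    rw [residueSet_fermat_thirtyNine, filter_stabilizer_eq_fermatCMType_thirtyNine]
    exact witnesses_thirtyNine.1.2.2
  · refine ⟨not_le_adjoin_zetaOf_pow_of_exists_not_mem_filter Φ₁ h₁ hp₁ 13 ⟨7, witnesses_thirtyNine.2.1,
      by exact_mod_cast witnesses_thirtyNine.2.2.1, ?_⟩, isCyclotomicExtension_adjoin_zetaOf_pow (N := 39) (a := 13) (b := 3) rfl⟩
    rw [residueSet_fermat_thirtyNine, filter_stabilizer_eq_fermatCMType_thirtyNine]
    exact witnesses_thirtyNine.2.2.2

/-- **Short form at `39`**: every abelian variety of type `(ℚ(ζ₃₉); Φ_{(1,16,22)})` is isogenous to `E¹²` for a SIMPLE CM ELLIPTIC CURVE `E`.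
[cite: KoblitzRohrlich1978, §2 Remark 2 (p. 1193)] -/
theorem exists_isIsogeny_pow_twelve_elliptic_thirtyNine'
    (hA : IsCMTypeRealisation (cmTypeOfResidues (L := L) (fermatCMType 39 1 16 22) hS) A ι θ) :
    ∃ (E : AbelianVariety ℂ), E.IsSimple ∧ Milne1999.IsOfCMType E ∧ E.dim = 1 ∧
      ∃ (P : AbelianVariety ℂ) (π : Fin 12 → (P ⟶ E)), Nonempty (IsLimit (Fan.mk P π)) ∧ ∃ g : A ⟶ P, IsIsogeny g := by
  obtain ⟨K₁, Φ₁, -, -, -, -, -, -, -, -, E, ιE, θE, hE, hs, hdim, P, π, hP, g, hg, -⟩ :=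
    exists_isIsogeny_pow_twelve_elliptic_thirtyNine hA
  exact ⟨E, hs, isOfCMType_of_isCMTypeRealisation hE, hdim, P, π, hP, g, hg⟩

/-- **Non-vacuity at `39`**: there IS a `12`-dimensional abelian variety of type `(ℚ(ζ₃₉); Φ_{(1,16,22)})`, and it is isogenous to the
twelfth power of a simple CM elliptic curve. [cite: KoblitzRohrlich1978, §2 Remark 2 (p. 1193)] [cite: Shimura1998, §6.2 Thm. 3] -/
theorem exists_realisation_isIsogeny_pow_twelve_elliptic_thirtyNine :
    ∃ (hS : ∀ c : ZMod 39, c.val.Coprime 39 → (c ∈ fermatCMType 39 1 16 22 ↔ -c ∉ fermatCMType 39 1 16 22))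
      (A : AbelianVariety ℂ) (ι : 𝓞 L →+* End A) (θ : L →+* Module.End ℂ (complexBetti A.X 1)),
      IsCMTypeRealisation (cmTypeOfResidues (L := L) (fermatCMType 39 1 16 22) hS) A ι θ ∧ A.dim = 12 ∧
      ∃ (E : AbelianVariety ℂ), E.IsSimple ∧ E.dim = 1 ∧
        ∃ (P : AbelianVariety ℂ) (π : Fin 12 → (P ⟶ E)), Nonempty (IsLimit (Fan.mk P π)) ∧ ∃ g : A ⟶ P, IsIsogeny g := by
  obtain ⟨hS, A, ι, θ, hA, hd⟩ := exists_isCMTypeRealisation_fermat (L := L) (M := 39) (by norm_num)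
    (r := 1) (s := 16) (t := 22) (by decide) (by decide) (by decide) (by decide)
  obtain ⟨E, hs, -, hdim, P, π, hP, g, hg⟩ := exists_isIsogeny_pow_twelve_elliptic_thirtyNine' hA
  exact ⟨hS, A, ι, θ, hA, by rw [hd, card_fermatCMType_thirtyNine_one_sixteen_twentyTwo.2], E, hs, hdim, P, π, hP, g, hg⟩

end ThirtyNine

end CyclotomicFermatCMType

end Literature.AlgebraicGeometry.ComplexMultiplication

end
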